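import Literature.MathematicalPhysics.QuantumFieldTheory.Balaban1983to89.Beta.BalabanStepW2

/-!
# `BalabanUV.Beta.GAN24.LinSandwichShape` — binder row G-an2-4 / (CONV-C), W-slot road «W3», ROWS W3-F3a∕F3b (T-marg)∕(T-irr), THE FIRST
# (GENERAL-TABLE) STEP (RULINGS-14b (R14-7)): `−(c • mmRead N (K ∘ ½(vertex2OfK K N X + swap) ∘ K))` OF ANY `LocStencil₂` TABLE IS A
# `LocStencil₂` FAMILY, CONSTANT LINEAR IN THE TABLE's

NOT IN PRINT; OUR PROOF ATTEMPT (G-an2-4 formalisation swarm, leaf prover `b2b-balaban-gan24-formalise-leaf-10`, gen 17, holder of ROW W3-F3a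
«W3-TMARG*» (journal l.8086, owner ACK l.8133); the CHAIN piece announced l.8502; module name PROVISIONAL — the row owner gan24-p1 may rename ∕
re-cut).  HONEST FRAMING (cell contract, verbatim): «discharging `BetaPertH` makes Bałaban's UV stability UNCONDITIONAL — a real constructive-QFT
result; it is NOT the continuum limit and NOT the Clay problem.»  HONEST DEPENDENCY (verbatim): «continuum YM on T⁴ ⇐ BetaPertH ∧ nine spine
estimates (0/9 proved); BetaPertH ⇐ (D1) ∧ (D4) ∧ CAP+tail; G-an2-4 gates asym, D1 and NE2/3/4.»

WHAT.  The transport rows of the owner's END `WSlotT2OfPieces.t2Shape_of_rows` ∕ `t2Drift_of_rows` quantify over ALL bi-stencil tables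
`LocStencil₂ X C δ` (ff-valued or not), and the one-step map of record is leaf-04's `T2RecursionAffine.lin4 c K N X κ u κ′ u′ =
−(c • mmRead N (K ∘ vsym K N X κ u κ′ u′ ∘ K))`, `vsym = ½(vertex2OfK … κ u κ′ u′ + vertex2OfK … κ′ u′ κ u)`.  On ff-valued tables this is the
bond-symmetrised four-leg push (leaf-17's `Push4Sym.mmRead_sandwich_vsym_eq_push₄`) and the `k`-fold composite is ONE push through leg chains
(`Push4Iter.transport_symPush`) bounded by the marginal mass count (F3-core-a) (leaf-03's `Push4Locality` ∕ `Push4LocalityRecord`; this seat's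
`Push4LegMoves`); on a GENERAL table the first application is NOT a push (the kernel's mixed blocks see the table's non-ff blocks), but its
output is ff-valued.  (R14-7): «first step general (one-shot sandwich bound, output ff), the remaining k−1 steps = `push₄` by `legComp`-iterated
`respStep` legs».  THIS FILE is that first step, for every decaying packed kernel `K` (`Decays K CK m`), every blocking `N ≥ 1`, every table:
* §1 `biLoc_vsym_far` — the symmetrised one-shot bi-vertex `½(vertex2OfK K N X μ y ν y′ + vertex2OfK K N X ν y′ μ y)` is bi-localised at
  `(N•y, N•y)` with the far factor `e^{−(m₀/32)|N•y′ − N•y|₁}` (an2's `vertexFamily₂_vertex2OfK` ∕ `_swap` at `(N•y, N•y′)` ∕ `(N•y′, N•y)`, then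
  `BalabanStepW2.biLoc_far_of_pair`), `m₀ = min m δ`;
* §2 **`locStencil₂_mmRead_sandwich_vsym`** — `LocStencil₂ (κ u κ′ u′ ↦ mmRead N (K ∘ ½(…) ∘ K)) (cSand·C) (m₀/128)` with the explicit polynomial
  `cSand = |Fib d|·(|Fib d|·(CK·cBi d CK 1 m₀)·Zl(m₀/64)·CK)·Zl(m₀/128)` (an2's `biLoc_sandwich`, `BalabanStepJetsSucc.biLoc_mmRead`; `cBi_eq_mul` makes
  the linearity in `C` explicit), and **`locStencil₂_lin_step`** — the same for `−(c • …)`, i.e. LITERALLY the body of `lin4 c K N X` with `vsym`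
  written out (`lin4_apply`∕`vsym` rewrite into it by `rfl` once p210349 commits), constant `|c|·cSand·C`.
For an2's family `K♮_j = KStepUnit Lc j` the K-slot's uniform decay (`CombesThomas.UnitDecayK`) makes `cSand` free of `j`.  The pattern is
leaf-19's `T2SlotOfHW.locStencil₂_mmRead_K3OfK_family` restricted to the sandwich term.  [folklore] bookkeeping over an2's bricks BY NAME; cites
nothing, mints no `def`, no `def … : Prop`, instantiates no wall binder, 0 sorry.  Asserts NO shape of Bałaban's tables; moves no row by
itself (the first link of the W3-F3a chain); «T2Shape» ∕ «T2SupRate» OPEN; discharges NOTHING of (hW, hWall); NOT «W-slot closed», NEVER «G-an2-4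
closed»; NOT `BetaPertH`, NOT continuum, NOT Clay.  Unit `b2b-balaban-gan24-formalise-leaf-10` (gen 17), 2026-08-20.
-/

noncomputable section

open Finset
open scoped BigOperators
open Literature.MathematicalPhysics.QuantumFieldTheory
open Literature.MathematicalPhysics.QuantumFieldTheory.Balaban1983to89
open Literature.MathematicalPhysics.QuantumFieldTheory.Balaban1983to89.Beta
open B12Sec2to5 (l1 l1_nonneg)
open ExpKernelCalculus (MKer Decays BiLoc VertexFamily₂ comp Zl Zl_pos Zl_nonneg l1_sub_symm)
open OneStepResolventKernel (Fib decays_mono biLoc_mono)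
open BalabanCompositeJets (LocStencil₂)
open BalabanStepJetsSucc (mmRead biLoc_mmRead l1_sub_le_l1_smul_sub)
open SecondOrderResponse (vertex2OfK vertexFamily₂_vertex2OfK vertexFamily₂_vertex2OfK_swap cBi cBi_nonneg biLoc_sandwich biLoc_smul
  biLoc_neg)
open KernelWard (biLoc_add)
open BalabanStepW2 (biLoc_far_of_pair biLoc_le_mono locStencil₂_smul')

namespace Summit.QuantumFields.BalabanUV.Beta.GAN24.LinSandwichShape

variable {d : ℕ}

/-- [folklore] `cBi` is linear in the table constant: `cBi d CK C m = C · cBi d CK 1 m`. -/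
theorem cBi_eq_mul (CK C m : ℝ) : cBi d CK C m = C * cBi d CK 1 m := by
  unfold cBi; ring

/-- [folklore] **THE SYMMETRISED BI-VERTEX IS FAR-SMALL AT THE FIRST BOND**: for a kernel `K` decaying at `(CK, m₀)` and a table
`LocStencil₂ X C m₀` (`m₀ > 0`), the bond-symmetrised one-shot second-order vertex
`W μ y ν y′ := ½ • (vertex2OfK K N X μ y ν y′ + vertex2OfK K N X ν y′ μ y)` is bi-localised at `(N•y, N•y)` at rate `m₀/32` with the far factor
`e^{−(m₀/32)|N•y′ − N•y|₁}` and constant `cBi d CK C m₀` (an2's `vertexFamily₂_vertex2OfK` ∕ `_swap` — rate `m₀/8` at `(N•y, N•y′)` resp.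
`(N•y′, N•y)` —, then `BalabanStepW2.biLoc_far_of_pair`). -/
theorem biLoc_vsym_far {K : MKer (d + 1) (Fib d)} {CK m₀ : ℝ} (hK : Decays K CK m₀) (hCK : 0 ≤ CK) (hm₀ : 0 < m₀) {N : ℕ}
    {X : Fin (d + 1) → (Fin (d + 1) → ℤ) → Fin (d + 1) → (Fin (d + 1) → ℤ) → MKer (d + 1) (Fib d)} {C : ℝ} (hX : LocStencil₂ X C m₀)
    (μ : Fin (d + 1)) (y : Fin (d + 1) → ℤ) (ν : Fin (d + 1)) (y' : Fin (d + 1) → ℤ) :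
    BiLoc ((1 / 2 : ℝ) • (vertex2OfK K N X μ y ν y' + vertex2OfK K N X ν y' μ y)) ((N : ℤ) • y) ((N : ℤ) • y)
      (cBi d CK C m₀ * Real.exp (-(m₀ / 32) * l1 ((N : ℤ) • y' - (N : ℤ) • y))) (m₀ / 32) := by
  have hC : 0 ≤ C := hX.nonneg
  have hcBi : 0 ≤ cBi d CK C m₀ := cBi_nonneg hCK hC hm₀
  have h1 := vertexFamily₂_vertex2OfK (N := N) hK hCK hX hm₀
  have h2 := vertexFamily₂_vertex2OfK_swap (N := N) hK hCK hX hm₀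
  -- the symmetrised family at (N•y, N•y') and at (N•y', N•y)
  have hW₁ : BiLoc ((1 / 2 : ℝ) • (vertex2OfK K N X μ y ν y' + vertex2OfK K N X ν y' μ y)) ((N : ℤ) • y) ((N : ℤ) • y')
      (cBi d CK C m₀) (m₀ / 8) := by
    have h := biLoc_smul (1 / 2 : ℝ) (biLoc_add (h1 μ y ν y') (h2 μ y ν y'))
    have e : |(1 / 2 : ℝ)| * (cBi d CK C m₀ + cBi d CK C m₀) = cBi d CK C m₀ := by
      rw [abs_of_pos (by norm_num : (0 : ℝ) < 1 / 2)]; ring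
    rwa [e] at h
  have hW₂ : BiLoc ((1 / 2 : ℝ) • (vertex2OfK K N X μ y ν y' + vertex2OfK K N X ν y' μ y)) ((N : ℤ) • y') ((N : ℤ) • y)
      (cBi d CK C m₀) (m₀ / 8) := by
    have h := biLoc_smul (1 / 2 : ℝ) (biLoc_add (h2 ν y' μ y) (h1 ν y' μ y))
    have e : |(1 / 2 : ℝ)| * (cBi d CK C m₀ + cBi d CK C m₀) = cBi d CK C m₀ := by
      rw [abs_of_pos (by norm_num : (0 : ℝ) < 1 / 2)]; ring
    rw [e] at h
    dsimp only at h
    exact h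
  have h3 := biLoc_far_of_pair hW₁ hW₂ (show (0 : ℝ) ≤ m₀ / 8 by positivity)
  rw [show m₀ / 8 / 2 = m₀ / 16 by ring, show m₀ / 8 / 4 = m₀ / 32 by ring] at h3
  refine biLoc_le_mono h3 (by positivity) ?_ le_rfl
  exact mul_le_mul_of_nonneg_left (Real.exp_le_exp.2 (by nlinarith [l1_nonneg ((N : ℤ) • y' - (N : ℤ) • y)])) hcBi

/-- [folklore] The explicit constant of the one-shot sandwich bound, per unit table constant:
`cSand d CK m₀ = |Fib d|·(|Fib d|·(CK·cBi d CK 1 m₀)·Zl(m₀/64)·CK)·Zl(m₀/128)` (an2's `biLoc_sandwich` at rate `m₀/32`).  Written inline below —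
no definition is introduced; this docstring only names the polynomial. -/
theorem cSand_nonneg {CK m₀ : ℝ} (hCK : 0 ≤ CK) (hm₀ : 0 < m₀) :
    0 ≤ (Fintype.card (Fib d) : ℝ) * ((Fintype.card (Fib d) : ℝ) * (CK * cBi d CK 1 m₀) * Zl (d + 1) (m₀ / 32 / 2) * CK) *
      Zl (d + 1) (m₀ / 32 / 4) := by
  have h1 : 0 ≤ cBi d CK 1 m₀ := cBi_nonneg hCK zero_le_one hm₀
  have h2 := Zl_nonneg (D := d + 1) (show 0 < m₀ / 32 / 2 by positivity)
  have h3 := Zl_nonneg (D := d + 1) (show 0 < m₀ / 32 / 4 by positivity)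
  positivity

/-- [folklore] **THE ONE-SHOT SANDWICH SHAPE (first general step of ROW W3-F3a∕F3b, R14-7)**: for a packed kernel `K` decaying at `(CK, m)`,
a blocking `N ≥ 1` and ANY bi-stencil table `LocStencil₂ X C δ` (ff-valued or not), with `m₀ := min m δ`, the family
`(κ, u, κ′, u′) ↦ mmRead N (K ∘ ½(vertex2OfK K N X κ u κ′ u′ + vertex2OfK K N X κ′ u′ κ u) ∘ K)` is `LocStencil₂` at rate `m₀/128` with
constant `cSand(d, CK, m₀) · C` — LINEAR in the table constant, free of the table.  Route: `biLoc_vsym_far` (pair + swap ⟹ far-small),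
an2's `biLoc_sandwich` (`K ∘ · ∘ K`, rate `/4`), `BalabanStepJetsSucc.biLoc_mmRead` (read at the coarse points) — the
`T2SlotOfHW.locStencil₂_mmRead_K3OfK_family` pattern restricted to the sandwich term. -/
theorem locStencil₂_mmRead_sandwich_vsym {K : MKer (d + 1) (Fib d)} {CK m : ℝ} (hK : Decays K CK m) (hCK : 0 ≤ CK) (hm : 0 < m)
    {N : ℕ} (hN : 1 ≤ N) {X : Fin (d + 1) → (Fin (d + 1) → ℤ) → Fin (d + 1) → (Fin (d + 1) → ℤ) → MKer (d + 1) (Fib d)} {C δ : ℝ}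
    (hX : LocStencil₂ X C δ) (hδ : 0 < δ) :
    LocStencil₂ (fun κ u κ' u' => mmRead N (comp (comp K ((1 / 2 : ℝ) • (vertex2OfK K N X κ u κ' u' + vertex2OfK K N X κ' u' κ u))) K))
      ((Fintype.card (Fib d) : ℝ) * ((Fintype.card (Fib d) : ℝ) * (CK * cBi d CK 1 (min m δ)) * Zl (d + 1) (min m δ / 32 / 2) * CK) *
          Zl (d + 1) (min m δ / 32 / 4) * C)
      (min m δ / 128) := by
  have hC : 0 ≤ C := hX.nonneg
  set m₀ : ℝ := min m δ with hm₀_def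
  have hm₀ : 0 < m₀ := lt_min hm hδ
  have hK₀ : Decays K CK m₀ := decays_mono hK hCK le_rfl (min_le_left _ _)
  have hX₀ : LocStencil₂ X C m₀ := hX.mono (min_le_right _ _)
  have hK₃₂ : Decays K CK (m₀ / 32) := decays_mono hK₀ hCK le_rfl (by linarith)
  have hcBi1 : 0 ≤ cBi d CK 1 m₀ := cBi_nonneg hCK zero_le_one hm₀
  have hcBiC : 0 ≤ cBi d CK C m₀ := cBi_nonneg hCK hC hm₀
  have hZa := Zl_nonneg (D := d + 1) (show 0 < m₀ / 32 / 2 by positivity)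
  have hZb := Zl_nonneg (D := d + 1) (show 0 < m₀ / 32 / 4 by positivity)
  intro κ u κ' u'
  have hV := biLoc_vsym_far (N := N) hK₀ hCK hm₀ hX₀ κ u κ' u'
  have hS := biLoc_sandwich hK₃₂ hCK (by positivity) hV
  -- un-negate
  have hS' : BiLoc (comp (comp K ((1 / 2 : ℝ) • (vertex2OfK K N X κ u κ' u' + vertex2OfK K N X κ' u' κ u))) K)
      ((N : ℤ) • u) ((N : ℤ) • u)
      ((Fintype.card (Fib d) : ℝ) * ((Fintype.card (Fib d) : ℝ) *
        (CK * (cBi d CK C m₀ * Real.exp (-(m₀ / 32) * l1 ((N : ℤ) • u' - (N : ℤ) • u)))) * Zl (d + 1) (m₀ / 32 / 2) * CK) *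
        Zl (d + 1) (m₀ / 32 / 4)) (m₀ / 32 / 4) := by
    intro x z a b
    have h := hS x z a b
    rwa [abs_neg] at h
  have hR := biLoc_mmRead hN hS' (by positivity)
  refine biLoc_le_mono hR (by positivity) ?_ (le_of_eq (by ring))
  -- constant bookkeeping: pull `C` and the far factor out, weaken the far rate `m₀/32 → m₀/128` and undo the dilation
  rw [cBi_eq_mul CK C m₀]
  have hexp : Real.exp (-(m₀ / 32) * l1 ((N : ℤ) • u' - (N : ℤ) • u)) ≤ Real.exp (-(m₀ / 128) * l1 (u' - u)) :=
    Real.exp_le_exp.2 (by nlinarith [l1_sub_le_l1_smul_sub hN u' u, l1_nonneg (u' - u)])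
  calc (Fintype.card (Fib d) : ℝ) * ((Fintype.card (Fib d) : ℝ) *
        (CK * (C * cBi d CK 1 m₀ * Real.exp (-(m₀ / 32) * l1 ((N : ℤ) • u' - (N : ℤ) • u)))) * Zl (d + 1) (m₀ / 32 / 2) * CK) *
        Zl (d + 1) (m₀ / 32 / 4)
      = (Fintype.card (Fib d) : ℝ) * ((Fintype.card (Fib d) : ℝ) * (CK * cBi d CK 1 m₀) * Zl (d + 1) (m₀ / 32 / 2) * CK) *
          Zl (d + 1) (m₀ / 32 / 4) * C * Real.exp (-(m₀ / 32) * l1 ((N : ℤ) • u' - (N : ℤ) • u)) := by ring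
    _ ≤ (Fintype.card (Fib d) : ℝ) * ((Fintype.card (Fib d) : ℝ) * (CK * cBi d CK 1 m₀) * Zl (d + 1) (m₀ / 32 / 2) * CK) *
          Zl (d + 1) (m₀ / 32 / 4) * C * Real.exp (-(m₀ / 128) * l1 (u' - u)) :=
        mul_le_mul_of_nonneg_left hexp (by positivity)

/-- [folklore] **THE SAME WITH THE SCALAR AND THE SIGN OF `lin4`**: the family
`(κ, u, κ′, u′) ↦ −(c • mmRead N (K ∘ ½(vertex2OfK K N X κ u κ′ u′ + vertex2OfK K N X κ′ u′ κ u) ∘ K))` — LITERALLY the body of leaf-04's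
`T2RecursionAffine.lin4 c K N X` with `vsym` written out (`lin4_apply` ∕ `vsym` rewrite into it by `rfl`) — is `LocStencil₂` at rate
`min m δ / 128` with constant `|c| · cSand(d, CK, min m δ) · C`.  This is the FIRST (general-table) STEP of the transport rows W3-F3a∕F3b:
after it every table is ff-valued and the remaining steps are four-leg pushes (`Push4Sym.mmRead_sandwich_vsym_eq_push₄`). -/
theorem locStencil₂_lin_step {K : MKer (d + 1) (Fib d)} {CK m : ℝ} (hK : Decays K CK m) (hCK : 0 ≤ CK) (hm : 0 < m)
    {N : ℕ} (hN : 1 ≤ N) (c : ℝ) {X : Fin (d + 1) → (Fin (d + 1) → ℤ) → Fin (d + 1) → (Fin (d + 1) → ℤ) → MKer (d + 1) (Fib d)} {C δ : ℝ}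
    (hX : LocStencil₂ X C δ) (hδ : 0 < δ) :
    LocStencil₂ (fun κ u κ' u' => -(c • mmRead N (comp (comp K ((1 / 2 : ℝ) • (vertex2OfK K N X κ u κ' u' + vertex2OfK K N X κ' u' κ u))) K)))
      (|c| * ((Fintype.card (Fib d) : ℝ) * ((Fintype.card (Fib d) : ℝ) * (CK * cBi d CK 1 (min m δ)) * Zl (d + 1) (min m δ / 32 / 2) * CK) *
          Zl (d + 1) (min m δ / 32 / 4) * C))
      (min m δ / 128) := by
  have h := locStencil₂_smul' (-c) (locStencil₂_mmRead_sandwich_vsym hK hCK hm hN hX hδ)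
  rw [abs_neg] at h
  have e : (fun κ u κ' u' => -(c • mmRead N (comp (comp K ((1 / 2 : ℝ) • (vertex2OfK K N X κ u κ' u' + vertex2OfK K N X κ' u' κ u))) K))) =
      (fun κ u κ' u' => (-c) • mmRead N (comp (comp K ((1 / 2 : ℝ) • (vertex2OfK K N X κ u κ' u' + vertex2OfK K N X κ' u' κ u))) K)) := by
    funext κ u κ' u'; rw [neg_smul]
  rw [e]
  exact h

end Summit.QuantumFields.BalabanUV.Beta.GAN24.LinSandwichShape

end
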